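import Mathlib.MeasureTheory.Integral.Bochner.ContinuousLinearMap
import Summits.RiemannHypothesis.RiemannHypothesis.Theses.LeeYang
import Literature.NumberTheory.LFunctions.PolyaKernelRHProofs
import HarnessLib

/-!
# RiemannHypothesis / LeeYang — the thesis item `LeeyangThesis`: bookkeeping

Route `RiemannHypothesis/LeeYang`, item `stmt-RiemannHypothesis-0451` (`LeeyangThesis`, the
thesis X: the de Bruijn law `Φ(u) du / ∫Φ` is an Ising limit law) and its literal negation
`stmt-RiemannHypothesis-0457` (`LeeyangNeg`).

Write `μ_Φ := (∫⁻ Φ)⁻¹ • volume.withDensity Φ` for the explicit measure in both route decls (it is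
spelled out in full below; no definition or notation is introduced). This file records, sorry-free:
* the hypothesis of both items is satisfiable — `μ_Φ` IS a probability measure
  (`isProbabilityMeasure_deBruijnLaw`, `exists_probabilityMeasure_eq_deBruijnLaw`; uses
  `0 < ∫ Φ < ∞` from the tree's `deBruijnPhi_pos_holds`, `continuous_deBruijnPhi`,
  `integrable_exp_mul_deBruijnPhi`), so neither item is vacuous;
* for any `ν` with `↑ν = μ_Φ`: `LeeyangThesis ↔ IsIsingLimitLaw ν`, `LeeyangNeg ↔ ¬ IsIsingLimitLaw ν`
  (`leeyangThesis_iff_of_eq`, `leeyangNeg_iff_of_eq`), hence `LeeyangNeg ↔ ¬ LeeyangThesis`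
  (`leeyangNeg_iff_not_leeyangThesis`): the two items are exact negations of each other;
* the Laplace transform of such `ν` is `(∫Φ)⁻¹ ∫ e^{zu} Φ(u) du` (`integral_exp_mul_of_eq`), so `ν`
  has the Lee–Yang property iff all zeros of `z ↦ ∫ e^{zu} Φ(u) du` are imaginary
  (`hasLeeYangProperty_iff_of_eq`) — the hypothesis of the route's `Assembly`;
* hence X is at least RH-hard: `LeeyangThesis`, together with Newman's closure theorem
  `hasLeeYangProperty_of_isIsingLimitLaw` (named fact: Ising limit laws are Lee–Yang), implies
  `RiemannHypothesis` (`riemannHypothesis_of_leeyangThesis`, via the discharged fact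
  `riemannHypothesis_of_deBruijnPhi_laplace_zeros_holds`).
-/

noncomputable section

namespace Summit.RiemannHypothesis.LeeYang

open MeasureTheory Literature.NumberTheory.LFunctions Literature.Probability.LatticeModels
open scoped ENNReal

/-! ### The normalising constant `∫ Φ` -/

/-- `Φ` is integrable on `ℝ` (the case `z = 0` of the tree's `integrable_exp_mul_deBruijnPhi`).
[folklore] -/
theorem integrable_deBruijnPhi : Integrable deBruijnPhi := by
  have h := (integrable_exp_mul_deBruijnPhi 0).re
  refine h.congr (Filter.Eventually.of_forall fun u => ?_)
  simp

/-- `Φ` is measurable (it is continuous). [folklore] -/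
theorem measurable_deBruijnPhi : Measurable deBruijnPhi :=
  continuous_deBruijnPhi.measurable

/-- The density `u ↦ ofReal (Φ u)` is measurable. [folklore] -/
theorem measurable_ofReal_deBruijnPhi : Measurable fun u => ENNReal.ofReal (deBruijnPhi u) :=
  measurable_deBruijnPhi.ennreal_ofReal

/-- `∫ Φ < ∞` as a lower Lebesgue integral. [folklore] -/
theorem lintegral_deBruijnPhi_ne_top : (∫⁻ u, ENNReal.ofReal (deBruijnPhi u)) ≠ ∞ :=
  integrable_deBruijnPhi.lintegral_lt_top.ne

/-- `∫ Φ > 0`, since `Φ > 0` everywhere (`deBruijnPhi_pos_holds`). [folklore] -/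
theorem lintegral_deBruijnPhi_ne_zero : (∫⁻ u, ENNReal.ofReal (deBruijnPhi u)) ≠ 0 := by
  refine ((lintegral_pos_iff_support measurable_ofReal_deBruijnPhi).2 ?_).ne'
  have : Function.support (fun u => ENNReal.ofReal (deBruijnPhi u)) = Set.univ := by
    refine Set.eq_univ_of_forall fun u => ?_
    simp only [Function.mem_support, ne_eq, ENNReal.ofReal_eq_zero, not_le]
    exact deBruijnPhi_pos_holds u
  simp [this]

/-- The normalising constant `∫ Φ` is a positive real. [folklore] -/
theorem toReal_lintegral_deBruijnPhi_pos :
    0 < (∫⁻ u, ENNReal.ofReal (deBruijnPhi u)).toReal :=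
  ENNReal.toReal_pos lintegral_deBruijnPhi_ne_zero lintegral_deBruijnPhi_ne_top

/-- The total mass of `volume.withDensity Φ` is `∫ Φ`. [folklore] -/
theorem withDensity_deBruijnPhi_univ :
    (volume.withDensity fun u => ENNReal.ofReal (deBruijnPhi u)) Set.univ =
      ∫⁻ u, ENNReal.ofReal (deBruijnPhi u) := by
  rw [withDensity_apply _ MeasurableSet.univ, Measure.restrict_univ]

/-! ### Non-vacuity: the normalised de Bruijn law is a probability measure -/

/-- **Non-vacuity.** The normalised de Bruijn law `(∫⁻ Φ)⁻¹ • volume.withDensity Φ` is a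
probability measure. [folklore] -/
theorem isProbabilityMeasure_deBruijnLaw :
    IsProbabilityMeasure ((∫⁻ u, ENNReal.ofReal (deBruijnPhi u))⁻¹ •
      volume.withDensity (fun u => ENNReal.ofReal (deBruijnPhi u))) := by
  refine ⟨?_⟩
  rw [Measure.smul_apply, withDensity_deBruijnPhi_univ, smul_eq_mul,
    ENNReal.inv_mul_cancel lintegral_deBruijnPhi_ne_zero lintegral_deBruijnPhi_ne_top]

/-- The hypothesis of items `0451`/`0457` is satisfiable: some `ν : ProbabilityMeasure ℝ` has
`↑ν = (∫⁻ Φ)⁻¹ • volume.withDensity Φ`. [folklore] -/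
theorem exists_probabilityMeasure_eq_deBruijnLaw :
    ∃ ν : ProbabilityMeasure ℝ, (ν : Measure ℝ) =
      (∫⁻ u, ENNReal.ofReal (deBruijnPhi u))⁻¹ •
        volume.withDensity (fun u => ENNReal.ofReal (deBruijnPhi u)) :=
  ⟨⟨_, isProbabilityMeasure_deBruijnLaw⟩, rfl⟩

/-! ### The items as statements about the one law `μ_Φ` -/

section OfEq

variable {ν : ProbabilityMeasure ℝ}
  (hν : (ν : Measure ℝ) = (∫⁻ u, ENNReal.ofReal (deBruijnPhi u))⁻¹ •
    volume.withDensity (fun u => ENNReal.ofReal (deBruijnPhi u)))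
include hν

/-- For `ν = μ_Φ`: `LeeyangThesis ↔ IsIsingLimitLaw ν` (the hypothesis pins `ν` down uniquely).
[folklore] -/
theorem leeyangThesis_iff_of_eq :
    RiemannHypothesis.Theses.LeeYang.LeeyangThesis ↔ IsIsingLimitLaw ν := by
  refine ⟨fun h => h ν hν, fun h ν' hν' => ?_⟩
  have : ν' = ν := ProbabilityMeasure.toMeasure_injective (hν'.trans hν.symm)
  rw [this]
  exact h

/-- For `ν = μ_Φ`: `LeeyangNeg ↔ ¬ IsIsingLimitLaw ν`. [folklore] -/
theorem leeyangNeg_iff_of_eq :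
    RiemannHypothesis.Theses.LeeYang.LeeyangNeg ↔ ¬ IsIsingLimitLaw ν := by
  refine ⟨fun h => h ν hν, fun h ν' hν' => ?_⟩
  have : ν' = ν := ProbabilityMeasure.toMeasure_injective (hν'.trans hν.symm)
  rw [this]
  exact h

/-- Integration against `μ_Φ`: `∫ g dμ_Φ = (∫Φ)⁻¹ ∫ Φ(u) g(u) du` (complex-valued `g`).
[folklore] -/
theorem integral_of_eq (g : ℝ → ℂ) :
    ∫ u, g u ∂(ν : Measure ℝ) =
      ((∫⁻ u, ENNReal.ofReal (deBruijnPhi u)).toReal)⁻¹ • ∫ u, (deBruijnPhi u : ℂ) * g u := by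
  rw [hν, integral_smul_measure, ENNReal.toReal_inv,
    integral_withDensity_eq_integral_toReal_smul measurable_ofReal_deBruijnPhi
      (Filter.Eventually.of_forall fun _ => ENNReal.ofReal_lt_top)]
  congr 1
  refine integral_congr_ae (Filter.Eventually.of_forall fun u => ?_)
  simp only [ENNReal.toReal_ofReal (deBruijnPhi_pos_holds u).le, Complex.real_smul]

/-- The Laplace transform of `μ_Φ` is `(∫Φ)⁻¹ · ∫ e^{zu} Φ(u) du`. [folklore] -/
theorem integral_exp_mul_of_eq (z : ℂ) :
    ∫ u, Complex.exp (z * u) ∂(ν : Measure ℝ) =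
      ((∫⁻ u, ENNReal.ofReal (deBruijnPhi u)).toReal)⁻¹ •
        ∫ u : ℝ, Complex.exp (z * u) * (deBruijnPhi u : ℂ) := by
  rw [integral_of_eq hν]
  congr 1
  refine integral_congr_ae (Filter.Eventually.of_forall fun u => ?_)
  simp only [mul_comm]

/-- `μ_Φ` has the Lee–Yang property iff every zero of `z ↦ ∫ e^{zu} Φ(u) du` is purely imaginary
(the hypothesis of the route's `Assembly`). [folklore] -/
theorem hasLeeYangProperty_iff_of_eq :
    HasLeeYangProperty (ν : Measure ℝ) ↔
      ∀ z : ℂ, (∫ u : ℝ, Complex.exp (z * u) * (deBruijnPhi u : ℂ)) = 0 → z.re = 0 := by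
  have hc : ((∫⁻ u, ENNReal.ofReal (deBruijnPhi u)).toReal)⁻¹ ≠ 0 :=
    inv_ne_zero toReal_lintegral_deBruijnPhi_pos.ne'
  unfold HasLeeYangProperty
  refine forall_congr' fun z => ?_
  rw [integral_exp_mul_of_eq hν, smul_eq_zero]
  constructor
  · exact fun h hz => h (Or.inr hz)
  · intro h hz
    exact h (hz.resolve_left hc)

/-- For `ν = μ_Φ`: if `ν` is an Ising limit law then, by Newman's closure theorem (named fact
`hasLeeYangProperty_of_isIsingLimitLaw`), RH holds. [folklore] -/
theorem riemannHypothesis_of_isIsingLimitLaw_of_eq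
    (hN : hasLeeYangProperty_of_isIsingLimitLaw) (h : IsIsingLimitLaw ν) :
    Summit.RiemannHypothesis :=
  riemannHypothesis_of_deBruijnPhi_laplace_zeros_holds
    ((hasLeeYangProperty_iff_of_eq hν).1 (hN ν h))

end OfEq

/-! ### Consequences for the items -/

/-- Items `0451` (`LeeyangThesis`) and `0457` (`LeeyangNeg`) are literal negations of each other:
settling either settles the other. [folklore] -/
theorem leeyangNeg_iff_not_leeyangThesis :
    RiemannHypothesis.Theses.LeeYang.LeeyangNeg ↔
      ¬ RiemannHypothesis.Theses.LeeYang.LeeyangThesis := by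
  obtain ⟨ν, hν⟩ := exists_probabilityMeasure_eq_deBruijnLaw
  rw [leeyangNeg_iff_of_eq hν, leeyangThesis_iff_of_eq hν]

/-- **X is at least RH-hard.** The thesis `LeeyangThesis`, combined with Newman's theorem that
Ising limit laws have the Lee–Yang property (named fact
`Literature.Probability.LatticeModels.hasLeeYangProperty_of_isIsingLimitLaw`, Newman 1974 Thm. 3 /
Lieb–Sokal 1981), implies the Riemann hypothesis, via Pólya's representation
`∫ e^{zu} Φ = 2 H₀(iz)` (discharged fact `riemannHypothesis_of_deBruijnPhi_laplace_zeros_holds`).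
[folklore] -/
theorem riemannHypothesis_of_leeyangThesis
    (hN : hasLeeYangProperty_of_isIsingLimitLaw)
    (hX : RiemannHypothesis.Theses.LeeYang.LeeyangThesis) : Summit.RiemannHypothesis := by
  obtain ⟨ν, hν⟩ := exists_probabilityMeasure_eq_deBruijnLaw
  exact riemannHypothesis_of_isIsingLimitLaw_of_eq hν hN ((leeyangThesis_iff_of_eq hν).1 hX)

/-- Contrapositive bookkeeping: if RH fails then (given Newman's closure theorem) the thesis fails,
i.e. `LeeyangNeg` holds. [folklore] -/
theorem leeyangNeg_of_not_riemannHypothesis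
    (hN : hasLeeYangProperty_of_isIsingLimitLaw) (h : ¬ Summit.RiemannHypothesis) :
    RiemannHypothesis.Theses.LeeYang.LeeyangNeg :=
  leeyangNeg_iff_not_leeyangThesis.2 fun hX => h (riemannHypothesis_of_leeyangThesis hN hX)

end Summit.RiemannHypothesis.LeeYang
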